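import Summits.RiemannHypothesis.RiemannHypothesis.Theorems.IntegerScrewCensusDualModelDeriv

/-!
# Route `IntegerScrew` — kernel checker for the census DUAL certificates (7): the slacks dominate the error budget

Real lower bounds for the integer slacks of `IntegerScrewCensusDualCheckW.slacksW` and `lamOf`, and the amplitude sums
`ampSumsW` as explicit sums.  RH-free; nothing here bears on the truth of RH.
-/

set_option linter.dupNamespace false
set_option autoImplicit false

namespace Summit.RiemannHypothesis.RiemannHypothesis.Theorems.IntegerScrew.Manifest.Fast

open Finset
open Literature.Analysis.ValidatedNumerics.KroneckerDot

/-! ### Floor helpers -/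

/-- `⌊a/b⌋ + 1 > a/b`. -/
theorem natDiv_succ_gt (a : ℕ) {b : ℕ} (hb : 0 < b) : (a : ℝ) / b < ((a / b + 1 : ℕ) : ℝ) := by
  have := (Literature.NumberTheory.LFunctions.ChainCheck.natDiv_real_bounds a hb).2
  push_cast; linarith

/-- `MR^D = 2^{R·D}`. -/
theorem MR_pow (D : ℕ) : ((2 ^ (RB * D) : ℕ) : ℝ) = (MR : ℝ) ^ D := by
  rw [show MR = 2 ^ RB from rfl]; push_cast; rw [← pow_mul]

/-! ### The slacks -/

/-- The common piece: `dr ≥ 2^60 (δ(1+ρ) + ρ)` with `δ = 31·Un/(500·2^52)`, `ρ = 2(C1N/2^52)^{D−1}/(D−1)!`. -/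
theorem dr_ge (D Un C1N : ℕ) :
    (2 : ℝ) ^ 60 * ((31 * (Un : ℝ) / (500 * 2 ^ 52)) * (1 + 2 * ((C1N : ℝ) / 2 ^ 52) ^ (D - 1) / (D - 1).factorial) +
        2 * ((C1N : ℝ) / 2 ^ 52) ^ (D - 1) / (D - 1).factorial) ≤
      ((((31 * Un * 2 ^ 8 / 500 + 1) * (2 ^ 60 + (2 * C1N ^ (D - 1) * 2 ^ 60 / (2 ^ (52 * (D - 1)) * Nat.factorial (D - 1)) + 1)) / 2 ^ 60 + 1 + (2 * C1N ^ (D - 1) * 2 ^ 60 / (2 ^ (52 * (D - 1)) * Nat.factorial (D - 1)) + 1)) : ℕ) : ℝ) := by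
  set ρ : ℝ := 2 * ((C1N : ℝ) / 2 ^ 52) ^ (D - 1) / (D - 1).factorial with hρ
  set δ : ℝ := 31 * (Un : ℝ) / (500 * 2 ^ 52) with hδ
  have hρ0 : 0 ≤ ρ := by positivity
  have hδ0 : 0 ≤ δ := by positivity
  have hrho : 2 ^ 60 * ρ ≤ (((2 * C1N ^ (D - 1) * 2 ^ 60 / (2 ^ (52 * (D - 1)) * Nat.factorial (D - 1)) + 1) : ℕ) : ℝ) := by
    have h := natDiv_succ_gt (2 * C1N ^ (D - 1) * 2 ^ 60) (b := 2 ^ (52 * (D - 1)) * Nat.factorial (D - 1)) (by positivity)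
    have e : ((2 * C1N ^ (D - 1) * 2 ^ 60 : ℕ) : ℝ) / ((2 ^ (52 * (D - 1)) * Nat.factorial (D - 1) : ℕ) : ℝ) = 2 ^ 60 * ρ := by
      rw [hρ]; push_cast; rw [div_pow, pow_mul]; field_simp; ring
    rw [e] at h; exact h.le
  have hdel : 2 ^ 60 * δ ≤ (((31 * Un * 2 ^ 8 / 500 + 1) : ℕ) : ℝ) := by
    have h := natDiv_succ_gt (31 * Un * 2 ^ 8) (b := 500) (by norm_num)
    have e : ((31 * Un * 2 ^ 8 : ℕ) : ℝ) / ((500 : ℕ) : ℝ) = 2 ^ 60 * δ := by rw [hδ]; push_cast; field_simp; ring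
    rw [e] at h; exact h.le
  set R60 : ℕ := (2 * C1N ^ (D - 1) * 2 ^ 60 / (2 ^ (52 * (D - 1)) * Nat.factorial (D - 1)) + 1) with hR60
  set D60 : ℕ := (31 * Un * 2 ^ 8 / 500 + 1) with hD60
  have hdr : (D60 : ℝ) * (2 ^ 60 + R60) / 2 ^ 60 + R60 ≤ (((D60 * (2 ^ 60 + R60) / 2 ^ 60 + 1 + R60 : ℕ)) : ℝ) := by
    have h := natDiv_succ_gt (D60 * (2 ^ 60 + R60)) (b := 2 ^ 60) (by positivity)
    push_cast at h ⊢; linarith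
  have h1 : 2 ^ 60 * (δ * (1 + ρ)) ≤ (D60 : ℝ) * (2 ^ 60 + R60) / 2 ^ 60 := by
    rw [le_div_iff₀ (by positivity)]
    have := mul_le_mul hdel (show 2 ^ 60 * (1 + ρ) ≤ (2 : ℝ) ^ 60 + R60 by linarith) (by positivity) (by positivity)
    nlinarith
  nlinarith

/-- **`S0` dominates the value error budget**: `S0 ≥ M^D (K0 ΣA (δ(1+ρ) + ρ + Δ') + (D+1) 2^105 ΣA)`. -/
theorem slacksW_S0_ge (D E Un C1N sumA Wm : ℕ) :
    (MR : ℝ) ^ D * ((K0N D E : ℝ) * sumA *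
        ((31 * (Un : ℝ) / (500 * 2 ^ 52)) * (1 + 2 * ((C1N : ℝ) / 2 ^ 52) ^ (D - 1) / (D - 1).factorial) +
          2 * ((C1N : ℝ) / 2 ^ 52) ^ (D - 1) / (D - 1).factorial + (Wm : ℝ) / 2 ^ 46) +
        ((D : ℝ) + 1) * 2 ^ 105 * sumA) ≤ ((slacksW D E Un C1N sumA Wm).1 : ℝ) := by
  have hdr := dr_ge D Un C1N
  unfold slacksW
  simp only
  set dr : ℕ := ((31 * Un * 2 ^ 8 / 500 + 1) * (2 ^ 60 + (2 * C1N ^ (D - 1) * 2 ^ 60 / (2 ^ (52 * (D - 1)) * Nat.factorial (D - 1)) + 1)) / 2 ^ 60 + 1 + (2 * C1N ^ (D - 1) * 2 ^ 60 / (2 ^ (52 * (D - 1)) * Nat.factorial (D - 1)) + 1)) with hdrdef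
  set b0 := dr + 2 ^ 14 * Wm with hb0
  have hb0r : 2 ^ 60 * ((31 * (Un : ℝ) / (500 * 2 ^ 52)) * (1 + 2 * ((C1N : ℝ) / 2 ^ 52) ^ (D - 1) / (D - 1).factorial) +
      2 * ((C1N : ℝ) / 2 ^ 52) ^ (D - 1) / (D - 1).factorial + (Wm : ℝ) / 2 ^ 46) ≤ (b0 : ℝ) := by
    rw [hb0]; push_cast
    have : (2 : ℝ) ^ 60 * ((Wm : ℝ) / 2 ^ 46) = 2 ^ 14 * Wm := by field_simp
    linarith
  have hmain : (K0N D E : ℝ) * sumA * ((31 * (Un : ℝ) / (500 * 2 ^ 52)) * (1 + 2 * ((C1N : ℝ) / 2 ^ 52) ^ (D - 1) / (D - 1).factorial) +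
      2 * ((C1N : ℝ) / 2 ^ 52) ^ (D - 1) / (D - 1).factorial + (Wm : ℝ) / 2 ^ 46) ≤ ((K0N D E * sumA * b0 / 2 ^ 60 + 1 : ℕ) : ℝ) := by
    have h := natDiv_succ_gt (K0N D E * sumA * b0) (b := 2 ^ 60) (by positivity)
    refine le_trans ?_ h.le
    push_cast
    rw [le_div_iff₀ (by positivity)]
    have hK : (0 : ℝ) ≤ (K0N D E : ℝ) * sumA := by positivity
    nlinarith
  rw [← MR_pow]
  push_cast
  have hM : (0 : ℝ) ≤ ((2 : ℝ) ^ (RB * D)) := by positivity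
  push_cast at hmain
  nlinarith

/-- **`S1` dominates the first-derivative error budget**:
`S1 ≥ M^D·2·(K0 ΣA (c₁(δ(1+ρ)+ρ) + Δ'(1+c₁)) + (D+1)² 2^105 ΣA)`, `c₁ = C1N/2^52`. -/
theorem slacksW_S1_ge (D E Un C1N sumA Wm : ℕ) :
    (MR : ℝ) ^ D * (2 * ((K0N D E : ℝ) * sumA *
        (((C1N : ℝ) / 2 ^ 52) * ((31 * (Un : ℝ) / (500 * 2 ^ 52)) * (1 + 2 * ((C1N : ℝ) / 2 ^ 52) ^ (D - 1) / (D - 1).factorial) +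
          2 * ((C1N : ℝ) / 2 ^ 52) ^ (D - 1) / (D - 1).factorial) + (Wm : ℝ) / 2 ^ 46 * (1 + (C1N : ℝ) / 2 ^ 52)) +
        ((D : ℝ) + 1) ^ 2 * 2 ^ 105 * sumA)) ≤ ((slacksW D E Un C1N sumA Wm).2.1 : ℝ) := by
  have hdr := dr_ge D Un C1N
  unfold slacksW
  simp only
  set dr : ℕ := ((31 * Un * 2 ^ 8 / 500 + 1) * (2 ^ 60 + (2 * C1N ^ (D - 1) * 2 ^ 60 / (2 ^ (52 * (D - 1)) * Nat.factorial (D - 1)) + 1)) / 2 ^ 60 + 1 + (2 * C1N ^ (D - 1) * 2 ^ 60 / (2 ^ (52 * (D - 1)) * Nat.factorial (D - 1)) + 1)) with hdrdef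
  set X : ℝ := (31 * (Un : ℝ) / (500 * 2 ^ 52)) * (1 + 2 * ((C1N : ℝ) / 2 ^ 52) ^ (D - 1) / (D - 1).factorial) +
          2 * ((C1N : ℝ) / 2 ^ 52) ^ (D - 1) / (D - 1).factorial with hX
  have hX0 : 0 ≤ X := by positivity
  set b1 := C1N * dr / 2 ^ 52 + 1 + 2 ^ 14 * Wm * (2 ^ 52 + C1N) / 2 ^ 52 + 1 with hb1
  have hb1r : 2 ^ 60 * (((C1N : ℝ) / 2 ^ 52) * X + (Wm : ℝ) / 2 ^ 46 * (1 + (C1N : ℝ) / 2 ^ 52)) ≤ (b1 : ℝ) := by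
    have h1 := natDiv_succ_gt (C1N * dr) (b := 2 ^ 52) (by positivity)
    have h2 := natDiv_succ_gt (2 ^ 14 * Wm * (2 ^ 52 + C1N)) (b := 2 ^ 52) (by positivity)
    have e : (b1 : ℝ) = ((C1N * dr / 2 ^ 52 + 1 : ℕ) : ℝ) + ((2 ^ 14 * Wm * (2 ^ 52 + C1N) / 2 ^ 52 + 1 : ℕ) : ℝ) := by
      rw [hb1]; push_cast; ring
    rw [e]
    have t1 : 2 ^ 60 * (((C1N : ℝ) / 2 ^ 52) * X) ≤ ((C1N * dr : ℕ) : ℝ) / ((2 ^ 52 : ℕ) : ℝ) := by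
      push_cast
      rw [le_div_iff₀ (by positivity)]
      have := mul_le_mul_of_nonneg_left hdr (Nat.cast_nonneg C1N)
      nlinarith
    have t2 : 2 ^ 60 * ((Wm : ℝ) / 2 ^ 46 * (1 + (C1N : ℝ) / 2 ^ 52)) ≤ ((2 ^ 14 * Wm * (2 ^ 52 + C1N) : ℕ) : ℝ) / ((2 ^ 52 : ℕ) : ℝ) := by
      push_cast
      rw [le_div_iff₀ (by positivity)]
      ring_nf
      nlinarith [Nat.cast_nonneg (α := ℝ) Wm, Nat.cast_nonneg (α := ℝ) C1N]
    linarith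
  have hmain : (K0N D E : ℝ) * sumA * (((C1N : ℝ) / 2 ^ 52) * X + (Wm : ℝ) / 2 ^ 46 * (1 + (C1N : ℝ) / 2 ^ 52)) ≤
      ((K0N D E * sumA * b1 / 2 ^ 60 + 1 : ℕ) : ℝ) := by
    have h := natDiv_succ_gt (K0N D E * sumA * b1) (b := 2 ^ 60) (by positivity)
    refine le_trans ?_ h.le
    push_cast
    rw [le_div_iff₀ (by positivity)]
    have hK : (0 : ℝ) ≤ (K0N D E : ℝ) * sumA := by positivity
    nlinarith
  rw [← MR_pow]
  push_cast
  have hM : (0 : ℝ) ≤ ((2 : ℝ) ^ (RB * D)) := by positivity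
  push_cast at hmain
  nlinarith

/-- **`S2` dominates the second-derivative error budget**:
`S2 ≥ M^D·4·(K0 ΣA (c₁²(δ(1+ρ)+ρ) + Δ'(2c₁+c₁²)) + (D+2)³ 2^105 ΣA)`. -/
theorem slacksW_S2_ge (D E Un C1N sumA Wm : ℕ) :
    (MR : ℝ) ^ D * (4 * ((K0N D E : ℝ) * sumA *
        (((C1N : ℝ) / 2 ^ 52) ^ 2 * ((31 * (Un : ℝ) / (500 * 2 ^ 52)) * (1 + 2 * ((C1N : ℝ) / 2 ^ 52) ^ (D - 1) / (D - 1).factorial) +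
          2 * ((C1N : ℝ) / 2 ^ 52) ^ (D - 1) / (D - 1).factorial) +
          (Wm : ℝ) / 2 ^ 46 * (2 * ((C1N : ℝ) / 2 ^ 52) + ((C1N : ℝ) / 2 ^ 52) ^ 2)) +
        ((D : ℝ) + 2) ^ 3 * 2 ^ 105 * sumA)) ≤ ((slacksW D E Un C1N sumA Wm).2.2 : ℝ) := by
  have hdr := dr_ge D Un C1N
  unfold slacksW
  simp only
  set dr : ℕ := ((31 * Un * 2 ^ 8 / 500 + 1) * (2 ^ 60 + (2 * C1N ^ (D - 1) * 2 ^ 60 / (2 ^ (52 * (D - 1)) * Nat.factorial (D - 1)) + 1)) / 2 ^ 60 + 1 + (2 * C1N ^ (D - 1) * 2 ^ 60 / (2 ^ (52 * (D - 1)) * Nat.factorial (D - 1)) + 1)) with hdrdef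
  set X : ℝ := (31 * (Un : ℝ) / (500 * 2 ^ 52)) * (1 + 2 * ((C1N : ℝ) / 2 ^ 52) ^ (D - 1) / (D - 1).factorial) +
          2 * ((C1N : ℝ) / 2 ^ 52) ^ (D - 1) / (D - 1).factorial with hX
  have hX0 : 0 ≤ X := by positivity
  set b2 := C1N * C1N * dr / 2 ^ 104 + 1 + 2 ^ 14 * Wm * (2 * C1N * 2 ^ 52 + C1N * C1N) / 2 ^ 104 + 1 with hb2
  have hb2r : 2 ^ 60 * (((C1N : ℝ) / 2 ^ 52) ^ 2 * X + (Wm : ℝ) / 2 ^ 46 * (2 * ((C1N : ℝ) / 2 ^ 52) + ((C1N : ℝ) / 2 ^ 52) ^ 2)) ≤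
      (b2 : ℝ) := by
    have h1 := natDiv_succ_gt (C1N * C1N * dr) (b := 2 ^ 104) (by positivity)
    have h2 := natDiv_succ_gt (2 ^ 14 * Wm * (2 * C1N * 2 ^ 52 + C1N * C1N)) (b := 2 ^ 104) (by positivity)
    have e : (b2 : ℝ) = ((C1N * C1N * dr / 2 ^ 104 + 1 : ℕ) : ℝ) + ((2 ^ 14 * Wm * (2 * C1N * 2 ^ 52 + C1N * C1N) / 2 ^ 104 + 1 : ℕ) : ℝ) := by
      rw [hb2]; push_cast; ring
    rw [e]
    have t1 : 2 ^ 60 * (((C1N : ℝ) / 2 ^ 52) ^ 2 * X) ≤ ((C1N * C1N * dr : ℕ) : ℝ) / ((2 ^ 104 : ℕ) : ℝ) := by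
      push_cast
      rw [le_div_iff₀ (by positivity)]
      have := mul_le_mul_of_nonneg_left hdr (by positivity : (0 : ℝ) ≤ (C1N : ℝ) * C1N)
      nlinarith
    have t2 : 2 ^ 60 * ((Wm : ℝ) / 2 ^ 46 * (2 * ((C1N : ℝ) / 2 ^ 52) + ((C1N : ℝ) / 2 ^ 52) ^ 2)) ≤
        ((2 ^ 14 * Wm * (2 * C1N * 2 ^ 52 + C1N * C1N) : ℕ) : ℝ) / ((2 ^ 104 : ℕ) : ℝ) := by
      push_cast
      rw [le_div_iff₀ (by positivity)]
      ring_nf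
      nlinarith [Nat.cast_nonneg (α := ℝ) Wm, Nat.cast_nonneg (α := ℝ) C1N]
    linarith
  have hmain : (K0N D E : ℝ) * sumA * (((C1N : ℝ) / 2 ^ 52) ^ 2 * X +
      (Wm : ℝ) / 2 ^ 46 * (2 * ((C1N : ℝ) / 2 ^ 52) + ((C1N : ℝ) / 2 ^ 52) ^ 2)) ≤ ((K0N D E * sumA * b2 / 2 ^ 60 + 1 : ℕ) : ℝ) := by
    have h := natDiv_succ_gt (K0N D E * sumA * b2) (b := 2 ^ 60) (by positivity)
    refine le_trans ?_ h.le
    push_cast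
    rw [le_div_iff₀ (by positivity)]
    have hK : (0 : ℝ) ≤ (K0N D E : ℝ) * sumA := by positivity
    nlinarith
  rw [← MR_pow]
  push_cast
  have hM : (0 : ℝ) ≤ ((2 : ℝ) ^ (RB * D)) := by positivity
  push_cast at hmain
  nlinarith

/-- **The cubic coefficient**: `lamOf D E amp3 ≥ M^D K0 (64/3) amp3/2^156`. -/
theorem lamOf_ge (D E amp3 : ℕ) :
    (MR : ℝ) ^ D * ((K0N D E : ℝ) * (64 / 3) * ((amp3 : ℝ) / 2 ^ 156)) ≤ (lamOf D E amp3 : ℝ) := by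
  unfold lamOf
  have h := natDiv_succ_gt (2 ^ (RB * D) * K0N D E * 64 * amp3) (b := 3 * 2 ^ 156) (by positivity)
  refine le_trans (le_of_eq ?_) h.le
  rw [← MR_pow]
  push_cast
  field_simp
  ring

/-! ### The amplitude sums -/

/-- `ampRowW` as explicit sums. -/
theorem ampRowW_eq (Wm φa : ℕ) : ∀ (zs : List ℤ) (φs : List ℕ), zs.length ≤ φs.length →
    ampRowW Wm φa zs φs = (∑ b ∈ range zs.length, 2 * (zs.getD b 0).natAbs,
      ∑ b ∈ range zs.length, 2 * (zs.getD b 0).natAbs * (φa - φs.getD b 0 + 16 * Wm) ^ 3)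
  | [], _, _ => by simp [ampRowW]
  | _ :: _, [], h => by simp at h
  | z :: zs, φb :: φs, h => by
    simp only [ampRowW]
    rw [ampRowW_eq Wm φa zs φs (by simpa using h)]
    simp only [List.length_cons, Finset.sum_range_succ', List.getD_cons_succ, List.getD_cons_zero]

/-- A row prefix `(Z_a).take a` has length `a` and the entries of the row. -/
theorem take_row {Z : List (List ℤ)} (hsq : ∀ row ∈ Z, row.length = Z.length) {a : ℕ} (ha : a < Z.length) :
    ((Z.getD a []).take a).length = a ∧ ∀ b, b < a → ((Z.getD a []).take a).getD b 0 = (Z.getD a []).getD b 0 := by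
  have hrow : (Z.getD a []).length = Z.length := by
    rw [List.getD_eq_getElem _ _ ha]; exact hsq _ (List.getElem_mem ha)
  refine ⟨by rw [List.length_take, hrow]; omega, fun b hb => ?_⟩
  rw [List.getD_eq_getElem?_getD, List.getElem?_take_of_lt hb, ← List.getD_eq_getElem?_getD]

/-- `sumN` is additive over append. -/
theorem sumN_append : ∀ (xs ys : List ℕ), sumN (xs ++ ys) = sumN xs + sumN ys
  | [], ys => by simp [sumN]
  | x :: xs, ys => by simp [sumN, sumN_append xs ys, Nat.add_assoc]

/-- `sumN` of a mapped `range`. -/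
theorem sumN_map_range (n : ℕ) (f : ℕ → ℕ) : sumN ((List.range n).map f) = ∑ a ∈ range n, f a := by
  induction n with
  | zero => simp [sumN]
  | succ n ih => rw [List.range_succ, List.map_append, sumN_append, ih, Finset.sum_range_succ]; simp [sumN]

/-- **The amplitude sum** `ΣA = Σ_a (2|rowsum_a| + Σ_{b<a} 2|Z_ab|)`. -/
theorem ampSumsW_fst (Z : List (List ℤ)) (φs : List ℕ) (Wm : ℕ) (hsq : ∀ row ∈ Z, row.length = Z.length)
    (hφ : Z.length ≤ φs.length) :
    ((ampSumsW Z φs Wm).1 : ℝ) = ∑ a ∈ range Z.length, (2 * |(sumZ (Z.getD a []) : ℝ)| +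
      ∑ b ∈ range a, 2 * |(((Z.getD a []).getD b 0 : ℤ) : ℝ)|) := by
  unfold ampSumsW
  simp only [List.map_map]
  rw [show ((List.range Z.length).map ((fun r : ℕ × ℕ => r.1) ∘ fun a => (2 * (sumZ (Z.getD a [])).natAbs +
      (ampRowW Wm (φs.getD a 0) ((Z.getD a []).take a) φs).1, 2 * (sumZ (Z.getD a [])).natAbs * (φs.getD a 0 + 16 * Wm) ^ 3 +
      (ampRowW Wm (φs.getD a 0) ((Z.getD a []).take a) φs).2))) = (List.range Z.length).map (fun a =>
      2 * (sumZ (Z.getD a [])).natAbs + (ampRowW Wm (φs.getD a 0) ((Z.getD a []).take a) φs).1) from rfl, sumN_map_range]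
  push_cast
  refine Finset.sum_congr rfl fun a ha => ?_
  rw [Finset.mem_range] at ha
  obtain ⟨hlen, hget⟩ := take_row hsq ha
  rw [ampRowW_eq Wm _ _ _ (by rw [hlen]; omega), hlen]
  push_cast
  rw [Nat.cast_natAbs, Int.cast_abs]
  congr 1
  refine Finset.sum_congr rfl fun b hb => ?_
  rw [Finset.mem_range] at hb
  rw [hget b hb, Nat.cast_natAbs, Int.cast_abs]

/-- **The cubic amplitude sum** `Σ|A|(φ+16W)³ = Σ_a (2|rowsum_a|(φ_a+16W)³ + Σ_{b<a} 2|Z_ab|(φ_a−φ_b+16W)³)`. -/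
theorem ampSumsW_snd (Z : List (List ℤ)) (φs : List ℕ) (Wm : ℕ) (hsq : ∀ row ∈ Z, row.length = Z.length)
    (hφ : Z.length ≤ φs.length) :
    ((ampSumsW Z φs Wm).2 : ℝ) = ∑ a ∈ range Z.length, (2 * |(sumZ (Z.getD a []) : ℝ)| * ((φs.getD a 0 : ℝ) + 16 * Wm) ^ 3 +
      ∑ b ∈ range a, 2 * |(((Z.getD a []).getD b 0 : ℤ) : ℝ)| * (((φs.getD a 0 - φs.getD b 0 : ℕ) : ℝ) + 16 * Wm) ^ 3) := by
  unfold ampSumsW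
  simp only [List.map_map]
  rw [show ((List.range Z.length).map ((fun r : ℕ × ℕ => r.2) ∘ fun a => (2 * (sumZ (Z.getD a [])).natAbs +
      (ampRowW Wm (φs.getD a 0) ((Z.getD a []).take a) φs).1, 2 * (sumZ (Z.getD a [])).natAbs * (φs.getD a 0 + 16 * Wm) ^ 3 +
      (ampRowW Wm (φs.getD a 0) ((Z.getD a []).take a) φs).2))) = (List.range Z.length).map (fun a =>
      2 * (sumZ (Z.getD a [])).natAbs * (φs.getD a 0 + 16 * Wm) ^ 3 + (ampRowW Wm (φs.getD a 0) ((Z.getD a []).take a) φs).2)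
      from rfl, sumN_map_range]
  push_cast
  refine Finset.sum_congr rfl fun a ha => ?_
  rw [Finset.mem_range] at ha
  obtain ⟨hlen, hget⟩ := take_row hsq ha
  rw [ampRowW_eq Wm _ _ _ (by rw [hlen]; omega), hlen]
  push_cast
  rw [Nat.cast_natAbs, Int.cast_abs]
  congr 1
  refine Finset.sum_congr rfl fun b hb => ?_
  rw [Finset.mem_range] at hb
  rw [hget b hb, Nat.cast_natAbs, Int.cast_abs]

end Summit.RiemannHypothesis.RiemannHypothesis.Theorems.IntegerScrew.Manifest.Fast
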